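import Mathlib

/-!
# Bookkeeping for one-variable auxiliary-polynomial constructions

Elementary estimates used when an auxiliary function `F = Σ P_{ij} · (monomials in given power
series)` is built by Siegel's lemma and its leading coefficient is estimated at the archimedean
places (Gelfond–Schneider / André-type arguments in one variable):

* § 1 weighted partial sums of coefficient norms of complex power series,
  `S_n(f) := Σ_{i ≤ n} ‖a_i(f)‖ ρⁱ` (`0 ≤ ρ`): submultiplicativity (`weightedSum_mul_le`), powers,
  scalars, finite sums, the passage from a radius-type bound `‖a_n‖ tⁿ ≤ K` (`ρ < t`) to
  `S_n ≤ K/(1 - ρ/t)`, the resulting single-coefficient bound `‖a_n‖ ≤ U ρ^{-n}`, and the bound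
  for the bihomogeneous monomials `y₁ⁱ y₂^{D-i} (h¹² y₂^{k₂})ʲ (y₂^{k₁})^{D-j}`;
* § 2 integrality (over `ℤ`) of coefficients is preserved by products, powers, scalars and sums;
* § 3 a growth lemma: `K₀ (D+1)^e Θ^D < s^{D²}` for some `D ≥ 1` when `s > 1`.

All statements are folklore; no named facts. Consumer: the transcendence core of the line `Sketch`
for `Summit.Langlands.Langlands.Theses.CapacityClassicality.IntegralOverconvergentIsCongruence`.
-/

open scoped BigOperators
open Finset PowerSeries

noncomputable section

namespace Literature.NumberTheory.Transcendental
/-! ## § 1 Weighted partial sums of coefficient norms -/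

/-- Triangle versus square: for non-negative `u, w`,
`Σ_{m ≤ n} Σ_{i + j = m} u_i w_j ≤ (Σ_{i ≤ n} u_i)(Σ_{j ≤ n} w_j)`. [folklore] -/
theorem sum_range_sum_antidiagonal_le {u w : ℕ → ℝ} (hu : ∀ i, 0 ≤ u i) (hw : ∀ j, 0 ≤ w j)
    (n : ℕ) :
    ∑ m ∈ range (n + 1), ∑ x ∈ antidiagonal m, u x.1 * w x.2 ≤
      (∑ i ∈ range (n + 1), u i) * ∑ j ∈ range (n + 1), w j := by
  have h1 : ∀ m, ∑ x ∈ antidiagonal m, u x.1 * w x.2 =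
      ∑ i ∈ Ico 0 (m + 1), u i * w (m - i) := fun m ↦ by
    rw [Finset.Nat.sum_antidiagonal_eq_sum_range_succ (fun i j ↦ u i * w j) m,
      Finset.range_eq_Ico]
  simp_rw [h1]
  rw [Finset.range_eq_Ico, ← Finset.sum_Ico_Ico_comm, Finset.sum_mul]
  refine Finset.sum_le_sum fun i _ ↦ ?_
  rw [← Finset.mul_sum]
  refine mul_le_mul_of_nonneg_left ?_ (hu i)
  rw [Finset.sum_Ico_eq_sum_range]
  have hsub : range (n + 1 - i) ⊆ Ico 0 (n + 1) := by
    intro j hj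
    simp only [mem_range, mem_Ico, Nat.zero_le, true_and] at hj ⊢
    omega
  calc ∑ k ∈ range (n + 1 - i), w (i + k - i) = ∑ k ∈ range (n + 1 - i), w k := by
        refine Finset.sum_congr rfl fun k _ ↦ by rw [Nat.add_sub_cancel_left]
    _ ≤ ∑ j ∈ Ico 0 (n + 1), w j :=
        Finset.sum_le_sum_of_subset_of_nonneg hsub fun j _ _ ↦ hw j

/-- Submultiplicativity of the weighted partial sums `S_n(f) = Σ_{i ≤ n} ‖a_i(f)‖ ρⁱ` (`ρ ≥ 0`):
if `S_n(f) ≤ U` and `S_n(h) ≤ W` for all `n` (`U ≥ 0`) then `S_n(f h) ≤ U W`. [folklore] -/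
theorem weightedSum_mul_le {f h : PowerSeries ℂ} {ρ U W : ℝ} (hρ : 0 ≤ ρ) (hU : 0 ≤ U)
    (hf : ∀ n, ∑ i ∈ range (n + 1), ‖coeff i f‖ * ρ ^ i ≤ U)
    (hh : ∀ n, ∑ i ∈ range (n + 1), ‖coeff i h‖ * ρ ^ i ≤ W) (n : ℕ) :
    ∑ i ∈ range (n + 1), ‖coeff i (f * h)‖ * ρ ^ i ≤ U * W := by
  have hW : 0 ≤ W := le_trans (Finset.sum_nonneg fun i _ ↦ by positivity) (hh 0)
  calc ∑ m ∈ range (n + 1), ‖coeff m (f * h)‖ * ρ ^ m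
      ≤ ∑ m ∈ range (n + 1), ∑ x ∈ antidiagonal m,
          (‖coeff x.1 f‖ * ρ ^ x.1) * (‖coeff x.2 h‖ * ρ ^ x.2) := by
        refine Finset.sum_le_sum fun m _ ↦ ?_
        rw [PowerSeries.coeff_mul]
        have hsum : ‖∑ x ∈ antidiagonal m, coeff x.1 f * coeff x.2 h‖ * ρ ^ m ≤
            (∑ x ∈ antidiagonal m, ‖coeff x.1 f‖ * ‖coeff x.2 h‖) * ρ ^ m := by
          refine mul_le_mul_of_nonneg_right ((norm_sum_le _ _).trans (le_of_eq ?_))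
            (by positivity)
          exact Finset.sum_congr rfl fun x _ ↦ norm_mul _ _
        refine hsum.trans (le_of_eq ?_)
        rw [Finset.sum_mul]
        refine Finset.sum_congr rfl fun x hx ↦ ?_
        rw [HasAntidiagonal.mem_antidiagonal] at hx
        rw [← hx, pow_add]
        ring
    _ ≤ (∑ i ∈ range (n + 1), ‖coeff i f‖ * ρ ^ i) * ∑ j ∈ range (n + 1), ‖coeff j h‖ * ρ ^ j :=
        sum_range_sum_antidiagonal_le (u := fun i ↦ ‖coeff i f‖ * ρ ^ i)
          (w := fun j ↦ ‖coeff j h‖ * ρ ^ j) (fun i ↦ by positivity) (fun j ↦ by positivity) n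
    _ ≤ U * W := mul_le_mul (hf n) (hh n) (Finset.sum_nonneg fun j _ ↦ by positivity) hU

/-- Weighted partial sums of `1`: `S_n(1) ≤ 1`. [folklore] -/
theorem weightedSum_one_le {ρ : ℝ} (n : ℕ) :
    ∑ i ∈ range (n + 1), ‖coeff i (1 : PowerSeries ℂ)‖ * ρ ^ i ≤ 1 := by
  rw [Finset.sum_eq_single 0]
  · simp
  · intro i _ hi
    simp [PowerSeries.coeff_one, hi]
  · simp

/-- Weighted partial sums of powers: `S_n(f) ≤ U` (`U ≥ 0`) gives `S_n(f^m) ≤ U^m`. [folklore] -/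
theorem weightedSum_pow_le {f : PowerSeries ℂ} {ρ U : ℝ} (hρ : 0 ≤ ρ) (hU : 0 ≤ U)
    (hf : ∀ n, ∑ i ∈ range (n + 1), ‖coeff i f‖ * ρ ^ i ≤ U) (m n : ℕ) :
    ∑ i ∈ range (n + 1), ‖coeff i (f ^ m)‖ * ρ ^ i ≤ U ^ m := by
  induction m generalizing n with
  | zero => simpa using weightedSum_one_le (ρ := ρ) n
  | succ m ih =>
    rw [pow_succ, pow_succ]
    exact weightedSum_mul_le hρ (pow_nonneg hU m) ih hf n

/-- Weighted partial sums of a scalar multiple: `S_n(C e · f) ≤ ‖e‖ U`. [folklore] -/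
theorem weightedSum_C_mul_le {f : PowerSeries ℂ} {ρ U : ℝ} (e : ℂ)
    (hf : ∀ n, ∑ i ∈ range (n + 1), ‖coeff i f‖ * ρ ^ i ≤ U) (n : ℕ) :
    ∑ i ∈ range (n + 1), ‖coeff i (PowerSeries.C e * f)‖ * ρ ^ i ≤ ‖e‖ * U := by
  calc ∑ i ∈ range (n + 1), ‖coeff i (PowerSeries.C e * f)‖ * ρ ^ i
      = ‖e‖ * ∑ i ∈ range (n + 1), ‖coeff i f‖ * ρ ^ i := by
        rw [Finset.mul_sum]
        refine Finset.sum_congr rfl fun i _ ↦ ?_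
        rw [PowerSeries.coeff_C_mul, norm_mul, mul_assoc]
    _ ≤ ‖e‖ * U := mul_le_mul_of_nonneg_left (hf n) (norm_nonneg e)

/-- Weighted partial sums of a finite sum: `S_n(Σ_k f_k) ≤ Σ_k U_k`. [folklore] -/
theorem weightedSum_sum_le {ι : Type*} (s : Finset ι) {f : ι → PowerSeries ℂ} {ρ : ℝ}
    (hρ : 0 ≤ ρ) {U : ι → ℝ}
    (hf : ∀ k ∈ s, ∀ n, ∑ i ∈ range (n + 1), ‖coeff i (f k)‖ * ρ ^ i ≤ U k) (n : ℕ) :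
    ∑ i ∈ range (n + 1), ‖coeff i (∑ k ∈ s, f k)‖ * ρ ^ i ≤ ∑ k ∈ s, U k := by
  calc ∑ i ∈ range (n + 1), ‖coeff i (∑ k ∈ s, f k)‖ * ρ ^ i
      ≤ ∑ i ∈ range (n + 1), ∑ k ∈ s, ‖coeff i (f k)‖ * ρ ^ i := by
        refine Finset.sum_le_sum fun i _ ↦ ?_
        rw [map_sum, ← Finset.sum_mul]
        exact mul_le_mul_of_nonneg_right (norm_sum_le _ _) (pow_nonneg hρ i)
    _ = ∑ k ∈ s, ∑ i ∈ range (n + 1), ‖coeff i (f k)‖ * ρ ^ i := Finset.sum_comm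
    _ ≤ ∑ k ∈ s, U k := Finset.sum_le_sum fun k hk ↦ hf k hk n

/-- From a radius-type bound `‖a_n‖ tⁿ ≤ K` (`t > 0`) and `0 ≤ ρ < t`: the weighted partial sums at
`ρ` are bounded, `S_n(f) ≤ K / (1 - ρ/t)`. [folklore] -/
theorem weightedSum_le_of_radius {f : PowerSeries ℂ} {ρ t K : ℝ} (hρ : 0 ≤ ρ) (ht : 0 < t)
    (hρt : ρ < t) (hK : ∀ n, ‖coeff n f‖ * t ^ n ≤ K) (n : ℕ) :
    ∑ i ∈ range (n + 1), ‖coeff i f‖ * ρ ^ i ≤ K / (1 - ρ / t) := by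
  have hK0 : 0 ≤ K := le_trans (by positivity) (hK 0)
  have hq0 : 0 ≤ ρ / t := div_nonneg hρ ht.le
  have hq1 : ρ / t < 1 := (div_lt_one ht).mpr hρt
  have hterm : ∀ i, ‖coeff i f‖ * ρ ^ i ≤ K * (ρ / t) ^ i := by
    intro i
    have : ρ ^ i = t ^ i * (ρ / t) ^ i := by
      rw [div_pow, mul_div_cancel₀ _ (pow_ne_zero i ht.ne')]
    rw [this, ← mul_assoc]
    exact mul_le_mul_of_nonneg_right (hK i) (pow_nonneg hq0 i)
  calc ∑ i ∈ range (n + 1), ‖coeff i f‖ * ρ ^ i ≤ ∑ i ∈ range (n + 1), K * (ρ / t) ^ i :=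
        Finset.sum_le_sum fun i _ ↦ hterm i
    _ = K * ∑ i ∈ range (n + 1), (ρ / t) ^ i := (Finset.mul_sum _ _ _).symm
    _ ≤ K * (1 / (1 - ρ / t)) := by
        refine mul_le_mul_of_nonneg_left ?_ hK0
        have h := geom_sum_Ico_le_of_lt_one (m := 0) (n := n + 1) hq0 hq1
        rwa [← Finset.range_eq_Ico, pow_zero] at h
    _ = K / (1 - ρ / t) := by rw [mul_one_div]

/-- A single coefficient is controlled by the weighted partial sums:
`‖a_n(f)‖ ≤ U ρ^{-n}` (`ρ > 0`). [folklore] -/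
theorem norm_coeff_le_of_weightedSum_le {f : PowerSeries ℂ} {ρ U : ℝ} (hρ : 0 < ρ)
    (hf : ∀ n, ∑ i ∈ range (n + 1), ‖coeff i f‖ * ρ ^ i ≤ U) (n : ℕ) :
    ‖coeff n f‖ ≤ U * ρ⁻¹ ^ n := by
  have h1 : ‖coeff n f‖ * ρ ^ n ≤ U := by
    refine le_trans ?_ (hf n)
    rw [Finset.sum_range_succ]
    exact le_add_of_nonneg_left (Finset.sum_nonneg fun i _ ↦ by positivity)
  rw [inv_pow, ← div_eq_mul_inv, le_div_iff₀ (pow_pos hρ n)]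
  exact h1

/-- Coefficients commute with a ring homomorphism applied to a power series:
`‖a_n(f.map σ)‖ = ‖σ(a_n(f))‖`-type bookkeeping. [folklore] -/
theorem coeff_map_apply {R S : Type*} [CommSemiring R] [CommSemiring S] (σ : R →+* S)
    (f : PowerSeries R) (n : ℕ) : coeff n (f.map σ) = σ (coeff n f) :=
  PowerSeries.coeff_map σ n f

/-! ## § 2 Integrality of coefficients under the ring operations -/

section Integrality

variable {E : Type*} [CommRing E]

/-- Products of series with integral coefficients have integral coefficients. [folklore] -/
theorem isIntegral_coeff_mul {f h : PowerSeries E} (hf : ∀ n, IsIntegral ℤ (coeff n f))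
    (hh : ∀ n, IsIntegral ℤ (coeff n h)) (n : ℕ) : IsIntegral ℤ (coeff n (f * h)) := by
  rw [PowerSeries.coeff_mul]
  exact IsIntegral.sum _ fun x _ ↦ (hf x.1).mul (hh x.2)

/-- Powers of a series with integral coefficients have integral coefficients. [folklore] -/
theorem isIntegral_coeff_pow {f : PowerSeries E} (hf : ∀ n, IsIntegral ℤ (coeff n f)) (m n : ℕ) :
    IsIntegral ℤ (coeff n (f ^ m)) := by
  induction m generalizing n with
  | zero =>
    rw [pow_zero, PowerSeries.coeff_one]
    split_ifs
    · exact isIntegral_one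
    · exact isIntegral_zero
  | succ m ih =>
    rw [pow_succ]
    exact isIntegral_coeff_mul ih hf n

/-- `C e * f` has integral coefficients when `e` is integral and `f` has integral coefficients.
[folklore] -/
theorem isIntegral_coeff_C_mul {f : PowerSeries E} {e : E} (he : IsIntegral ℤ e)
    (hf : ∀ n, IsIntegral ℤ (coeff n f)) (n : ℕ) : IsIntegral ℤ (coeff n (PowerSeries.C e * f)) := by
  rw [PowerSeries.coeff_C_mul]
  exact he.mul (hf n)

/-- Finite sums of series with integral coefficients have integral coefficients. [folklore] -/
theorem isIntegral_coeff_sum {ι : Type*} (s : Finset ι) {f : ι → PowerSeries E}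
    (hf : ∀ k ∈ s, ∀ n, IsIntegral ℤ (coeff n (f k))) (n : ℕ) :
    IsIntegral ℤ (coeff n (∑ k ∈ s, f k)) := by
  rw [map_sum]
  exact IsIntegral.sum _ fun k hk ↦ hf k hk n

end Integrality

/-! ## § 3 An elementary growth lemma -/

/-- For `s > 1`, `Θ ≥ 1`, `K₀ ≥ 0` and `e : ℕ` there is `D ≥ 1` with `K₀ (D+1)^e Θ^D < s^{D^2}`:
exponential-of-a-square beats exponential times polynomial. [folklore] -/
theorem exists_poly_mul_exp_lt_exp_sq {s Θ K₀ : ℝ} (hs : 1 < s) (hΘ : 1 ≤ Θ) (hK₀ : 0 ≤ K₀)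
    (e : ℕ) : ∃ D : ℕ, 1 ≤ D ∧ K₀ * ((D : ℝ) + 1) ^ e * Θ ^ D < s ^ (D ^ 2) := by
  -- (a) eventually `K₀ 2^e D^e < s^D` (polynomial versus exponential)
  have h1 : ∀ᶠ D : ℕ in Filter.atTop, K₀ * 2 ^ e * (D : ℝ) ^ e < s ^ D := by
    have ht := tendsto_pow_const_div_const_pow_of_one_lt e hs
    have hpos : (0 : ℝ) < 1 / (K₀ * 2 ^ e + 1) := by positivity
    filter_upwards [ht.eventually (gt_mem_nhds hpos)] with D hD
    have hsD : (0 : ℝ) < s ^ D := pow_pos (zero_lt_one.trans hs) D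
    rw [div_lt_div_iff₀ hsD (by positivity), one_mul] at hD
    calc K₀ * 2 ^ e * (D : ℝ) ^ e ≤ (K₀ * 2 ^ e + 1) * (D : ℝ) ^ e := by
          refine mul_le_mul_of_nonneg_right (by linarith) (by positivity)
      _ = (D : ℝ) ^ e * (K₀ * 2 ^ e + 1) := by ring
      _ < s ^ D := hD
  -- (b) eventually `Θ² ≤ s^D`
  have h2 : ∀ᶠ D : ℕ in Filter.atTop, Θ ^ 2 ≤ s ^ D :=
    (tendsto_pow_atTop_atTop_of_one_lt hs).eventually_ge_atTop (Θ ^ 2)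
  obtain ⟨D, hD1, hD2, hD3⟩ := (h1.and (h2.and (Filter.eventually_ge_atTop 2))).exists
  refine ⟨D, by omega, ?_⟩
  have hs0 : (0 : ℝ) < s := zero_lt_one.trans hs
  have hsD1 : 1 ≤ s ^ D := one_le_pow₀ hs.le
  -- `(D+1)^e ≤ 2^e D^e`
  have hDe : ((D : ℝ) + 1) ^ e ≤ 2 ^ e * (D : ℝ) ^ e := by
    rw [← mul_pow]
    exact pow_le_pow_left₀ (by positivity) (by
      have : (1 : ℝ) ≤ D := by exact_mod_cast (show 1 ≤ D by omega)
      linarith) e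
  -- `Θ^D ≤ (Θ²)^(D-1) ≤ (s^D)^(D-1)`
  have hΘD : Θ ^ D ≤ (s ^ D) ^ (D - 1) := by
    calc Θ ^ D ≤ Θ ^ (2 * (D - 1)) := pow_le_pow_right₀ hΘ (by omega)
      _ = (Θ ^ 2) ^ (D - 1) := by rw [pow_mul]
      _ ≤ (s ^ D) ^ (D - 1) := pow_le_pow_left₀ (by positivity) hD2 _
  calc K₀ * ((D : ℝ) + 1) ^ e * Θ ^ D ≤ K₀ * (2 ^ e * (D : ℝ) ^ e) * (s ^ D) ^ (D - 1) :=
        mul_le_mul (mul_le_mul_of_nonneg_left hDe hK₀) hΘD (by positivity) (by positivity)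
    _ = (K₀ * 2 ^ e * (D : ℝ) ^ e) * (s ^ D) ^ (D - 1) := by ring
    _ < s ^ D * (s ^ D) ^ (D - 1) :=
        mul_lt_mul_of_pos_right hD1 (pow_pos (pow_pos hs0 D) _)
    _ = s ^ (D ^ 2) := by
        rw [← pow_succ', Nat.sub_add_cancel (by omega : 1 ≤ D), ← pow_mul, sq]

/-- Weighted partial sums of the auxiliary monomials
`y₁ⁱ y₂^{D-i} (h¹² y₂^{k₂})ʲ (y₂^{k₁})^{D-j}` are at most `L^{(13 + k₁ + k₂) D}` when those of
`y₁, y₂, h` are at most `L ≥ 1`. [folklore] -/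
theorem weightedSum_monomial_le {y₁ y₂ h : PowerSeries ℂ} {ρ L : ℝ} (hρ : 0 ≤ ρ) (hL : 1 ≤ L)
    (h₁ : ∀ n, ∑ i ∈ range (n + 1), ‖coeff i y₁‖ * ρ ^ i ≤ L)
    (h₂ : ∀ n, ∑ i ∈ range (n + 1), ‖coeff i y₂‖ * ρ ^ i ≤ L)
    (hh : ∀ n, ∑ i ∈ range (n + 1), ‖coeff i h‖ * ρ ^ i ≤ L)
    (k₁ k₂ D a b : ℕ) (ha : a ≤ D) (hb : b ≤ D) (n : ℕ) :
    ∑ i ∈ range (n + 1),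
      ‖coeff i (y₁ ^ a * y₂ ^ (D - a) * (h ^ 12 * y₂ ^ k₂) ^ b * (y₂ ^ k₁) ^ (D - b))‖ * ρ ^ i ≤
      L ^ ((13 + k₁ + k₂) * D) := by
  have hL0 : 0 ≤ L := zero_le_one.trans hL
  have e1 : ∀ n, ∑ i ∈ range (n + 1), ‖coeff i (y₁ ^ a)‖ * ρ ^ i ≤ L ^ a :=
    weightedSum_pow_le hρ hL0 h₁ a
  have e2 : ∀ n, ∑ i ∈ range (n + 1), ‖coeff i (y₂ ^ (D - a))‖ * ρ ^ i ≤ L ^ (D - a) :=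
    weightedSum_pow_le hρ hL0 h₂ (D - a)
  have e3 : ∀ n, ∑ i ∈ range (n + 1), ‖coeff i ((h ^ 12 * y₂ ^ k₂) ^ b)‖ * ρ ^ i ≤
      (L ^ 12 * L ^ k₂) ^ b :=
    weightedSum_pow_le hρ (by positivity)
      (weightedSum_mul_le hρ (by positivity) (weightedSum_pow_le hρ hL0 hh 12)
        (weightedSum_pow_le hρ hL0 h₂ k₂)) b
  have e4 : ∀ n, ∑ i ∈ range (n + 1), ‖coeff i ((y₂ ^ k₁) ^ (D - b))‖ * ρ ^ i ≤
      (L ^ k₁) ^ (D - b) :=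
    weightedSum_pow_le hρ (by positivity) (weightedSum_pow_le hρ hL0 h₂ k₁) (D - b)
  have e12 := weightedSum_mul_le hρ (by positivity) e1 e2
  have e123 := weightedSum_mul_le hρ (by positivity) e12 e3
  have e1234 := weightedSum_mul_le hρ (by positivity) e123 e4
  refine (e1234 n).trans ?_
  have hrw : L ^ a * L ^ (D - a) * (L ^ 12 * L ^ k₂) ^ b * (L ^ k₁) ^ (D - b) =
      L ^ (a + (D - a) + (12 + k₂) * b + k₁ * (D - b)) := by
    rw [← pow_add L 12 k₂, ← pow_mul, ← pow_mul, ← pow_add, ← pow_add, ← pow_add]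
  rw [hrw]
  refine pow_le_pow_right₀ hL ?_
  have h1 : a + (D - a) = D := by omega
  have h2 : (12 + k₂) * b ≤ (12 + k₂) * D := Nat.mul_le_mul_left _ hb
  have h3 : k₁ * (D - b) ≤ k₁ * D := Nat.mul_le_mul_left _ (Nat.sub_le D b)
  nlinarith [h1, h2, h3]

end Literature.NumberTheory.Transcendental

end
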